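import Literature.MathematicalPhysics.QuantumFieldTheory.Balaban1983to89.Beta.AliasingTailL1

/-!
# Aliasing tail, HYBRID rate `N^{-r} · e^{-κ|x|₁}`: integration by parts in one coordinate on top of the `ℓ¹` contour shift

Companion to `Beta.AliasingTailL1`. There, a multiplier `G` holomorphic and bounded by `M` on the closed polystrip
`S_κ = {|Im p_μ| ≤ κ}` has lattice kernel `|K(x)| ≤ M e^{-κ|x|₁}` and hence grid-sum-minus-BZ-mean
`‖T_N − K̂(0)‖ ≤ M · aliasConstL1 κ N d`, `aliasConstL1 κ N d = ((1+ρ)/(1−ρ))^{d+1} − 1`, `ρ = e^{-κN}`. When the usable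
strip is NARROW (small `κ`, because `M = sup_{S_κ} |G|` blows up near complex zeros of a denominator just outside a wide
strip), the rate `e^{-κN}` alone is too slow at affordable `N`. The classical remedy [folklore: the Euler–Maclaurin /
Poisson-summation error analysis of the periodic trapezoidal rule for analytic-periodic integrands] is to COMBINE the contour
shift with `r` integrations by parts in one coordinate: on the real Brillouin zone, `∫ ∂_μ^r G · e^{ip·x} dp =
(−i x_μ)^r ∫ G e^{ip·x} dp` (periodic boundary terms vanish), so that `|K_G(x)| ≤ |x_μ|^{-r} |K_{∂_μ^r G}(x)| ≤
D |x_μ|^{-r} e^{-κ|x|₁}` with `D = sup_{S_κ} |∂_μ^r G|`; at the nonzero coarse translates `x = N m`, `m ≠ 0`, some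
`|x_μ| ≥ N`, whence (this file's main theorem `norm_torusKernel_zero_sub_latticeKernel_zero_le_deriv_l1`)

  `‖T_N − K̂(0)‖ ≤ (D / N^r) · aliasConstL1 κ N d`,

and the export inequality `lo_le_of_aliasing_deriv_l1` in the shape of `Certified.lo_le_of_aliasing` /
`AliasingTailL1.lo_le_of_aliasing_l1`. By the maximum principle (applied by the USER, not here) `D` may be read off the
distinguished boundary `|Im p_μ| = κ` of the polystrip, far from the real torus.

## Sources
* Katznelson, An Introduction to Harmonic Analysis (3rd ed. 2004), Ch. I Thm. 1.6 (`\hat F(n) = \hat f(n)/(in)`) and §4.4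
  (`\hat f(n) = (in)^{-j}\widehat{f^{(j)}}(n)`, `|\hat f(n)| ≤ min_j ‖f^{(j)}‖_{L¹}/|n|^j`) — the 1-D integration by parts.
* Grafakos, Classical Fourier Analysis (3rd ed. 2014), Thm. 3.3.9(a) and its proof, eq. (3.3.9), p. 196–197 — the
  coordinatewise `s`-fold integration by parts on `T^n` with the choice `|m_j| = sup_k |m_k|`.
* Trefethen–Weideman, The exponentially convergent trapezoidal rule, SIAM Rev. 56 (2014), §4: the aliasing formula (4.9)
  `I_N = 2π Σ_j c_{jN}` and Thm. 4.2 (4.16) (strip-analytic periodic integrands: `|I_N − I| ≤ 4πM/(e^{aN} − 1)`) — the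
  1-D prototype of `AliasingTailL1` and of the counting here.
* Bałaban, Propagators I (1984), p. 36 l. 20–23 / p. 38 (1.126) — the torus dictionary (periodisation), as in `AliasingTailL1`.

## Contents
* `norm_tsum_translate_sub_le_l1_of_ne` — the TRANSLATE-ONLY variant of `AliasingTailL1.norm_tsum_translate_sub_le_l1`: a bound
  `‖K(Nm)‖ ≤ M' e^{-κ|Nm|₁}` at the NONZERO translates only (here `M' = D N^{-r}`, false at `m = 0`) already gives
  `‖Σ_m K(Nm) − K(0)‖ ≤ M' · aliasConstL1 κ N d` (summability included).
* `integral_deriv_mul_char`, `integral_iteratedDeriv_mul_char` — 1-D integration by parts on `[-π, π]` against the character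
  `e^{itn}`, `n ∈ ℤ`, with periodic boundary values: `∫ f' e^{itn} = −(in) ∫ f e^{itn}`, iterated `r` times.
* `fourierBox_coordDeriv` — the same inside the box integral, in the coordinate `μ`, by the slicing of
  `B4ContourShift.fourierBox_eq_iterated`: `fourierBox (F r) x = (−i x_μ)^r · fourierBox (F 0) x` for a chain
  `F 0, …, F r` of successive `μ`-derivatives along the real coordinate lines (continuous, periodic at the endpoints).
* `norm_latticeKernel_le_deriv_l1`, `norm_latticeKernel_translate_le_deriv_l1` — the hybrid kernel bound and its reading at
  the nonzero coarse translates (a chain in EVERY coordinate, all `r`-th members `StripRegularC _ κ D`).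
* `norm_torusKernel_zero_sub_latticeKernel_zero_le_deriv_l1`, `lo_le_of_aliasing_deriv_l1` — torus reading and export.

## Design / what is NOT here
* The derivative chains are DATA supplied by the user (`F : Fin (d+1) → ℕ → multiplier` with `F μ 0 = G`), with the
  analytic hypotheses stated on the REAL Brillouin zone only (`HasDerivAt` along coordinate lines, continuity, periodicity,
  integrability of each `integrand (F μ j) x`) plus `StripRegularC (F μ r) κ D`; `StripRegularC G κ M` itself is needed only
  for the periodisation identity `B4TorusKernel.torusKernel_descend_eq`. No measurability is left implicit (every integral
  that appears is over an integrand assumed integrable or continuous on a compact interval).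
* NOT here: any concrete multiplier, any value of `κ, r, N, D` (those are the certified-enclosure side's inputs), the
  maximum-principle reduction of `D` to the distinguished boundary, and the `ℓ^∞`-shell refinement of the counting.
-/

namespace Literature.MathematicalPhysics.QuantumFieldTheory.Balaban1983to89.Beta.AliasingTailDeriv

open Complex Set MeasureTheory intervalIntegral
open Literature.MathematicalPhysics.QuantumFieldTheory.Balaban1983to89.B4Strip (ofRealVec Strip)
open Literature.MathematicalPhysics.QuantumFieldTheory.Balaban1983to89.B4ContourShift
open Literature.MathematicalPhysics.QuantumFieldTheory.Balaban1983to89.B4TorusKernel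
open Literature.MathematicalPhysics.QuantumFieldTheory.Balaban1983to89.Beta.AliasingTail
open Literature.MathematicalPhysics.QuantumFieldTheory.Balaban1983to89.Beta.AliasingTailL1
open scoped Real Interval

noncomputable section

variable {d : ℕ}

/-- TRANSLATE-ONLY variant of `norm_tsum_translate_sub_le_l1`: it suffices to bound the kernel at the NONZERO coarse translates
`y = N·m`, `m ≠ 0` — the shape needed when the bound at the translates carries an extra factor (e.g. `N^{-r}` from `r`
integrations by parts) that is false at `y = 0` — the aliasing formula `I_N − I = 2π Σ_{j ≠ 0} c_{jN}` summed against a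
geometric majorant. [cite: TrefethenWeideman2014, §4 eq. (4.9)–(4.10) with Thm. 4.2 eq. (4.16), p. 13–14] [cite: Balaban1984PropagatorsI, p. 36 l. 20–23 with p. 38 (1.126), dictionary] -/
theorem norm_tsum_translate_sub_le_l1_of_ne (K : (Fin (d + 1) → ℤ) → ℂ) {κ M : ℝ} (hκ : 0 < κ) (hM : 0 ≤ M) {N : ℕ} (hN : 1 ≤ N)
    (hK : ∀ m : Fin (d + 1) → ℤ, m ≠ 0 → ‖K (translate N 0 m)‖ ≤ M * Real.exp (-(κ * l1Norm (translate N 0 m)))) :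
    Summable (fun m : Fin (d + 1) → ℤ => K (translate N 0 m)) ∧
      ‖(∑' m : Fin (d + 1) → ℤ, K (translate N 0 m)) - K 0‖ ≤ M * aliasConstL1 κ N d := by
  set ρ := aliasRatioL1 κ N with hρ
  have hρ0 : 0 ≤ ρ := (aliasRatioL1_pos κ N).le
  have hρ1 : ρ < 1 := aliasRatioL1_lt_one hκ hN
  set g : (Fin (d + 1) → ℤ) → ℂ := fun m => if m = 0 then 0 else K (translate N 0 m) with hg
  set F₀ : (Fin (d + 1) → ℤ) → ℝ := fun m => M * ∏ i, absWeight ρ (m i) with hF₀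
  set F : (Fin (d + 1) → ℤ) → ℝ := fun m => if m = 0 then 0 else F₀ m with hF
  have hw := hasSum_absWeight hρ0 hρ1
  have hprod := summable_prod_pi (fun (_ : Fin (d + 1)) (j : ℤ) => absWeight ρ j) (fun _ j => absWeight_nonneg hρ0 j)
    (fun _ => hw.1)
  have hF₀s : Summable F₀ := hprod.1.mul_left M
  have hF₀sum : ∑' m, F₀ m = M * ((1 + ρ) / (1 - ρ)) ^ (d + 1) := by
    rw [hF₀]
    change ∑' m : Fin (d + 1) → ℤ, M * ∏ i, absWeight ρ (m i) = _
    rw [tsum_mul_left, hprod.2]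
    simp only [Finset.prod_const, Finset.card_univ, Fintype.card_fin]
    rw [hw.2]
  have hF₀0 : F₀ 0 = M := by simp [hF₀, absWeight]
  have hF₀nn : ∀ m, 0 ≤ F₀ m := fun m => mul_nonneg hM (Finset.prod_nonneg fun i _ => absWeight_nonneg hρ0 _)
  have hFs : Summable F := by
    refine Summable.of_nonneg_of_le (fun m => ?_) (fun m => ?_) hF₀s
    · simp only [hF]; split_ifs
      · exact le_rfl
      · exact hF₀nn m
    · simp only [hF]; split_ifs
      · exact hF₀nn m
      · exact le_rfl
  have hFsum : ∑' m, F m = M * aliasConstL1 κ N d := by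
    have hsplit := hF₀s.tsum_eq_add_tsum_ite 0
    have hF' : (fun m => if m = 0 then 0 else F₀ m) = F := by rfl
    rw [hF', hF₀sum, hF₀0] at hsplit
    unfold aliasConstL1; rw [← hρ]
    linarith
  have hgF : ∀ m, ‖g m‖ ≤ F m := by
    intro m
    rcases eq_or_ne m 0 with rfl | hm
    · simp [hg, hF]
    · simp only [hg, hm, if_false, hF, hF₀]
      have key : Real.exp (-(κ * l1Norm (translate N 0 m))) = ∏ i, absWeight ρ (m i) := by
        rw [l1Norm_translate_zero]
        unfold l1Norm
        have e : -(κ * ((N : ℝ) * ∑ i, |((m i : ℤ) : ℝ)|)) = ∑ i, ((m i).natAbs : ℝ) * (-(κ * N)) := by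
          rw [Finset.mul_sum, Finset.mul_sum, ← Finset.sum_neg_distrib]
          refine Finset.sum_congr rfl fun i _ => ?_
          rw [Nat.cast_natAbs, Int.cast_abs]; ring
        rw [e, Real.exp_sum]
        refine Finset.prod_congr rfl fun i _ => ?_
        rw [Real.exp_nat_mul, hρ]
        rfl
      calc ‖K (translate N 0 m)‖ ≤ M * Real.exp (-(κ * l1Norm (translate N 0 m))) := hK _ hm
        _ = M * ∏ i, absWeight ρ (m i) := by rw [key]
  have hgs : Summable (fun m => ‖g m‖) := Summable.of_nonneg_of_le (fun m => norm_nonneg _) hgF hFs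
  have hgs' : Summable g := hgs.of_norm
  -- `K ∘ translate` differs from `g` only at `m = 0`
  have hdec : (fun m : Fin (d + 1) → ℤ => K (translate N 0 m)) = fun m => g m + (if m = 0 then K 0 else 0) := by
    funext m
    rcases eq_or_ne m 0 with rfl | hm
    · simp [hg]
    · simp [hg, hm]
  have hsingle : Summable (fun m : Fin (d + 1) → ℤ => (if m = 0 then K 0 else (0 : ℂ))) :=
    summable_of_ne_finset_zero (s := {0}) (by intro m hm; simp at hm; simp [hm])
  have hs : Summable (fun m : Fin (d + 1) → ℤ => K (translate N 0 m)) := by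
    rw [hdec]; exact hgs'.add hsingle
  refine ⟨hs, ?_⟩
  have hsum : (∑' m : Fin (d + 1) → ℤ, K (translate N 0 m)) = (∑' m, g m) + K 0 := by
    rw [hdec, Summable.tsum_add hgs' hsingle, tsum_ite_eq]
  rw [hsum, add_sub_cancel_right]
  calc ‖∑' m, g m‖ ≤ ∑' m, ‖g m‖ := norm_tsum_le_tsum_norm hgs
    _ ≤ ∑' m, F m := hgs.tsum_le_tsum hgF hFs
    _ = M * aliasConstL1 κ N d := hFsum

/-! ### 1-D integration by parts against a character, periodic boundary -/

/-- the character `t ↦ e^{i t n}` has derivative `i n e^{i t n}` (helper). [folklore] -/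
private theorem hasDerivAt_cexp_char (n : ℤ) (t : ℝ) :
    HasDerivAt (fun s : ℝ => cexp (I * (s : ℂ) * n)) (I * n * cexp (I * (t : ℂ) * n)) t := by
  have h1 : HasDerivAt (fun s : ℝ => I * (s : ℂ) * n) (I * 1 * n) t := by
    have := (hasDerivAt_id t).ofReal_comp
    simpa using ((this.const_mul I).mul_const (n : ℂ))
  have h2 := h1.cexp
  simpa [mul_comm, mul_left_comm, mul_assoc] using h2

/-- `e^{iπn} = e^{-iπn}` for an integer `n` (helper). [folklore] -/
private theorem cexp_pi_char_eq (n : ℤ) : cexp (I * (π : ℂ) * n) = cexp (I * ((-π : ℝ) : ℂ) * n) := by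
  have h : I * (π : ℂ) * n = I * ((-π : ℝ) : ℂ) * n + n * (2 * π * I) := by push_cast; ring
  rw [h, Complex.exp_add, Complex.exp_int_mul_two_pi_mul_I, mul_one]

/-- INTEGRATION BY PARTS on `[-π, π]` with periodic boundary values: `∫ f' e^{itn} = -(in) ∫ f e^{itn}` (Katznelson's
`\hat F(n) = \hat f(n)/(in)` for the periodic primitive `F` of `f`; our character is `e^{+itn}`, whence the sign).
[cite: Katznelson2004, Ch. I Thm. 1.6 eq. (1.6)] -/
theorem integral_deriv_mul_char {f f' : ℝ → ℂ} {n : ℤ} (hf : ∀ t ∈ Set.uIcc (-π) π, HasDerivAt f (f' t) t)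
    (hf'i : IntervalIntegrable f' MeasureTheory.volume (-π) π) (hper : f (-π) = f π) :
    (∫ t in (-π)..π, f' t * cexp (I * (t : ℂ) * n)) = -(I * n) * ∫ t in (-π)..π, f t * cexp (I * (t : ℂ) * n) := by
  have hv : ∀ t ∈ Set.uIcc (-π) π, HasDerivAt (fun s : ℝ => cexp (I * (s : ℂ) * n)) (I * n * cexp (I * (t : ℂ) * n)) t :=
    fun t _ => hasDerivAt_cexp_char n t
  have hv'i : IntervalIntegrable (fun t : ℝ => I * n * cexp (I * (t : ℂ) * n)) MeasureTheory.volume (-π) π :=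
    (Continuous.continuousOn (by fun_prop)).intervalIntegrable
  have hparts := intervalIntegral.integral_mul_deriv_eq_deriv_mul hf hv hf'i hv'i
  -- boundary term vanishes
  have hb : f π * cexp (I * (π : ℝ) * n) - f (-π) * cexp (I * ((-π : ℝ) : ℂ) * n) = 0 := by
    rw [hper, show ((π : ℝ) : ℂ) = (π : ℂ) from rfl, cexp_pi_char_eq n]; ring
  have hlhs : (∫ t in (-π)..π, f t * (I * n * cexp (I * (t : ℂ) * n)))
      = (I * n) * ∫ t in (-π)..π, f t * cexp (I * (t : ℂ) * n) := by
    rw [← intervalIntegral.integral_const_mul]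
    congr 1; funext t; ring
  rw [hlhs] at hparts
  have : (I * n) * (∫ t in (-π)..π, f t * cexp (I * (t : ℂ) * n)) = -(∫ t in (-π)..π, f' t * cexp (I * (t : ℂ) * n)) := by
    rw [hparts, hb, zero_sub]
  rw [← neg_neg (∫ t in (-π)..π, f' t * cexp (I * (t : ℂ) * n)), ← this]; ring

/-- ITERATED: if `f^{(j)}` (`j ≤ r`) are successive derivatives on `[-π, π]`, each periodic at the endpoints and the last one
interval-integrable, then `∫ f^{(r)} e^{itn} = (-(in))^r ∫ f^{(0)} e^{itn}` (Katznelson I.4.4: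
`\hat f(n) = (in)^{-j} \widehat{f^{(j)}}(n)`). [cite: Katznelson2004, Ch. I §4.4 with Thm. 1.6] -/
theorem integral_iteratedDeriv_mul_char {n : ℤ} (r : ℕ) (F : ℕ → ℝ → ℂ)
    (hF : ∀ j < r, ∀ t ∈ Set.uIcc (-π) π, HasDerivAt (F j) (F (j + 1) t) t)
    (hFc : ∀ j ≤ r, ContinuousOn (F j) (Set.uIcc (-π) π)) (hper : ∀ j < r, F j (-π) = F j π) :
    (∫ t in (-π)..π, F r t * cexp (I * (t : ℂ) * n)) = (-(I * n)) ^ r * ∫ t in (-π)..π, F 0 t * cexp (I * (t : ℂ) * n) := by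
  induction r with
  | zero => simp
  | succ r ih =>
    have h1 := integral_deriv_mul_char (f := F r) (f' := F (r + 1)) (n := n) (hF r (Nat.lt_succ_self r))
      ((hFc (r + 1) le_rfl).intervalIntegrable) (hper r (Nat.lt_succ_self r))
    rw [h1, ih (fun j hj => hF j (Nat.lt_succ_of_lt hj)) (fun j hj => hFc j (Nat.le_succ_of_le hj))
      (fun j hj => hper j (Nat.lt_succ_of_lt hj))]
    ring

/-! ### Slicing: `r` integrations by parts in one coordinate of the box integral -/

/-- `r`-FOLD INTEGRATION BY PARTS IN THE COORDINATE `i` of the box Fourier integral: if `F 0, …, F r` are successive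
`i`-th partial derivatives along every real coordinate line (periodic at the endpoints, continuous), then
`∫ F_r e^{ip·x} = (−i x_i)^r ∫ F_0 e^{ip·x}` — Grafakos' (3.3.9): «integrating by parts `s` times with respect to the variable
`x_j` … where the boundary terms all vanish because of the periodicity of the integrand». [cite: Grafakos2014, Thm. 3.3.9(a) proof eq. (3.3.9), p. 197] -/
theorem fourierBox_coordDeriv (i : Fin (d + 1)) (r : ℕ) (F : ℕ → (Fin (d + 1) → ℂ) → ℂ) (x : Fin (d + 1) → ℤ)
    (hint : ∀ j ≤ r, IntegrableOn (integrand (F j) x) (BZ (d + 1)))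
    (hder : ∀ j < r, ∀ q ∈ BZ d, ∀ t ∈ Set.uIcc (-π) π,
      HasDerivAt (fun s : ℝ => F j (i.insertNth (s : ℂ) (ofRealVec q))) (F (j + 1) (i.insertNth (t : ℂ) (ofRealVec q))) t)
    (hcont : ∀ j ≤ r, ∀ q ∈ BZ d, ContinuousOn (fun s : ℝ => F j (i.insertNth (s : ℂ) (ofRealVec q))) (Set.uIcc (-π) π))
    (hper : ∀ j < r, ∀ q ∈ BZ d,
      F j (i.insertNth (((-π : ℝ)) : ℂ) (ofRealVec q)) = F j (i.insertNth ((π : ℝ) : ℂ) (ofRealVec q))) :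
    fourierBox (F r) x = (-(I * x i)) ^ r * fourierBox (F 0) x := by
  have hBZ : MeasurableSet (BZ d) := by unfold BZ; exact measurableSet_Icc
  rw [fourierBox_eq_iterated (F r) x i (hint r le_rfl), fourierBox_eq_iterated (F 0) x i (hint 0 (Nat.zero_le _)),
    ← MeasureTheory.integral_const_mul]
  refine setIntegral_congr_fun hBZ fun q hq => ?_
  set C : ℂ := cexp (I * phase q (fun j => x (i.succAbove j))) with hC
  -- the slices as interval integrals against the character
  have hI : ∀ j, (∫ t in Icc (-π) π, integrand (F j) x (i.insertNth t q))
      = ∫ t in (-π)..π, (F j (i.insertNth (t : ℂ) (ofRealVec q)) * C) * cexp (I * (t : ℂ) * (x i)) := by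
    intro j
    rw [intervalIntegral.integral_of_le (by linarith [Real.pi_pos] : -π ≤ π), integral_Icc_eq_integral_Ioc]
    refine setIntegral_congr_fun measurableSet_Ioc fun t _ => ?_
    simp only [integrand, ofRealVec_insertNth, phase_insertNth, mul_add, Complex.exp_add, hC]
    ring
  rw [hI r, hI 0]
  have key := integral_iteratedDeriv_mul_char (n := x i) r (fun j t => F j (i.insertNth (t : ℂ) (ofRealVec q)) * C)
    (fun j hj t ht => (hder j hj q hq t ht).mul_const C)
    (fun j hj => (hcont j hj q hq).mul continuousOn_const)
    (fun j hj => by simp only [hper j hj q hq])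
  simpa using key

/-! ### Assembly: the hybrid `ℓ¹ × |x_μ|^{-r}` kernel bound and the export inequality -/

/-- THE HYBRID KERNEL BOUND: if along the coordinate `μ` the multiplier `G` has `r` successive partial derivatives
`F 0 = G, …, F r` on the real Brillouin zone (periodic, continuous) and the `r`-th one is strip-regular with `|F r| ≤ D` on the
closed polystrip of half-width `κ`, then `|K_G(y)| ≤ D |y_μ|^{-r} e^{-κ|y|₁}` for `y_μ ≠ 0` (Grafakos (3.3.7)/(3.3.9) combined
with the `ℓ¹` contour-shift decay `AliasingTailL1.latticeKernel_decay_l1` of the `r`-th derivative). [cite: Grafakos2014, Thm. 3.3.9(a) eq. (3.3.7) with proof eq. (3.3.9), p. 196–197] -/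
theorem norm_latticeKernel_le_deriv_l1 {G : (Fin (d + 1) → ℂ) → ℂ} {κ D : ℝ} (hκ : 0 ≤ κ) (μ : Fin (d + 1)) (r : ℕ)
    (F : ℕ → (Fin (d + 1) → ℂ) → ℂ) (hF0 : F 0 = G)
    (hint : ∀ j ≤ r, ∀ x, IntegrableOn (integrand (F j) x) (BZ (d + 1)))
    (hder : ∀ j < r, ∀ q ∈ BZ d, ∀ t ∈ Set.uIcc (-π) π,
      HasDerivAt (fun s : ℝ => F j (μ.insertNth (s : ℂ) (ofRealVec q))) (F (j + 1) (μ.insertNth (t : ℂ) (ofRealVec q))) t)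
    (hcont : ∀ j ≤ r, ∀ q ∈ BZ d, ContinuousOn (fun s : ℝ => F j (μ.insertNth (s : ℂ) (ofRealVec q))) (Set.uIcc (-π) π))
    (hper : ∀ j < r, ∀ q ∈ BZ d,
      F j (μ.insertNth (((-π : ℝ)) : ℂ) (ofRealVec q)) = F j (μ.insertNth ((π : ℝ) : ℂ) (ofRealVec q)))
    (hH : StripRegularC (F r) κ D) (y : Fin (d + 1) → ℤ) (hy : y μ ≠ 0) :
    ‖latticeKernel G y‖ ≤ D / |(y μ : ℝ)| ^ r * Real.exp (-(κ * l1Norm y)) := by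
  have hb := fourierBox_coordDeriv μ r F y (fun j hj => hint j hj y) hder hcont hper
  rw [hF0] at hb
  have hK : latticeKernel (F r) y = (-(I * y μ)) ^ r * latticeKernel G y := by
    simp only [latticeKernel, hb, Complex.real_smul]
    ring
  have hn : ‖latticeKernel (F r) y‖ = |(y μ : ℝ)| ^ r * ‖latticeKernel G y‖ := by
    rw [hK, norm_mul, norm_pow, norm_neg, norm_mul, Complex.norm_I, one_mul, Complex.norm_intCast]
  have hdec := latticeKernel_decay_l1 hH hκ y
  rw [hn] at hdec
  have hpos : 0 < |(y μ : ℝ)| ^ r := pow_pos (abs_pos.mpr (by exact_mod_cast hy)) r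
  rw [div_mul_eq_mul_div, le_div_iff₀ hpos]
  linarith [mul_comm (|(y μ : ℝ)| ^ r) ‖latticeKernel G y‖]

/-- AT THE NONZERO COARSE TRANSLATES `y = N·m`, `m ≠ 0` (so `|y_μ| ≥ N` for some `μ`): with a derivative chain in EVERY
coordinate, `|K_G(N m)| ≤ D N^{-r} e^{-κ|Nm|₁}` (Grafakos: «pick a `j` such that `|m_j| = sup_k |m_k|`. Then clearly `m_j ≠ 0`»).
[cite: Grafakos2014, Thm. 3.3.9(a) proof, p. 197] -/
theorem norm_latticeKernel_translate_le_deriv_l1 {G : (Fin (d + 1) → ℂ) → ℂ} {κ D : ℝ} (hκ : 0 ≤ κ) (r : ℕ)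
    (F : Fin (d + 1) → ℕ → (Fin (d + 1) → ℂ) → ℂ) (hF0 : ∀ μ, F μ 0 = G)
    (hint : ∀ μ, ∀ j ≤ r, ∀ x, IntegrableOn (integrand (F μ j) x) (BZ (d + 1)))
    (hder : ∀ μ, ∀ j < r, ∀ q ∈ BZ d, ∀ t ∈ Set.uIcc (-π) π,
      HasDerivAt (fun s : ℝ => F μ j (μ.insertNth (s : ℂ) (ofRealVec q))) (F μ (j + 1) (μ.insertNth (t : ℂ) (ofRealVec q))) t)
    (hcont : ∀ μ, ∀ j ≤ r, ∀ q ∈ BZ d, ContinuousOn (fun s : ℝ => F μ j (μ.insertNth (s : ℂ) (ofRealVec q))) (Set.uIcc (-π) π))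
    (hper : ∀ μ, ∀ j < r, ∀ q ∈ BZ d,
      F μ j (μ.insertNth (((-π : ℝ)) : ℂ) (ofRealVec q)) = F μ j (μ.insertNth ((π : ℝ) : ℂ) (ofRealVec q)))
    (hH : ∀ μ, StripRegularC (F μ r) κ D) {N : ℕ} (hN : 1 ≤ N) (m : Fin (d + 1) → ℤ) (hm : m ≠ 0) :
    ‖latticeKernel G (translate N 0 m)‖ ≤ D / (N : ℝ) ^ r * Real.exp (-(κ * l1Norm (translate N 0 m))) := by
  obtain ⟨μ, hμ⟩ : ∃ μ, m μ ≠ 0 := by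
    by_contra hall
    push Not at hall
    exact hm (funext hall)
  have hyμ : translate N 0 m μ = (N : ℤ) * m μ := by rw [translate_zero_apply]
  have hy : translate N 0 m μ ≠ 0 := by
    rw [hyμ]; exact mul_ne_zero (by exact_mod_cast (by omega : N ≠ 0)) hμ
  have h0 : (0 : Fin (d + 1) → ℂ) ∈ PolyStrip (fun _ : Fin (d + 1) => κ) := fun _ => by
    simp only [Pi.zero_apply, Complex.zero_re, Complex.zero_im, abs_zero]
    exact ⟨Real.pi_pos.le, hκ⟩
  have hD : 0 ≤ D := le_trans (norm_nonneg _) ((hH μ).bound 0 h0)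
  have h1 := norm_latticeKernel_le_deriv_l1 hκ μ r (F μ) (hF0 μ) (hint μ) (hder μ) (hcont μ) (hper μ) (hH μ) _ hy
  refine h1.trans (mul_le_mul_of_nonneg_right ?_ (Real.exp_pos _).le)
  -- `D / |y_μ|^r ≤ D / N^r` since `|y_μ| = N |m_μ| ≥ N`
  have hNpos : (0 : ℝ) < (N : ℝ) ^ r := pow_pos (by exact_mod_cast (by omega : 0 < N)) r
  have hge : (N : ℝ) ≤ |((translate N 0 m μ : ℤ) : ℝ)| := by
    rw [hyμ]; push_cast
    rw [abs_mul, Nat.abs_cast]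
    have : (1 : ℝ) ≤ |((m μ : ℤ) : ℝ)| := by
      rw [← Int.cast_abs]; exact_mod_cast Int.one_le_abs hμ
    nlinarith [(Nat.cast_nonneg N : (0 : ℝ) ≤ N)]
  exact div_le_div_of_nonneg_left hD hNpos (pow_le_pow_left₀ (Nat.cast_nonneg N) hge r)

/-- GRID SUM VERSUS BRILLOUIN-ZONE MEAN, HYBRID RATE: `StripRegularC G κ M` (`κ > 0`, for the periodisation), a derivative
chain of length `r` in every coordinate whose last members are `StripRegularC _ κ D`, and `N ≥ 1` ⇒
`‖T_N − latticeKernel G 0‖ ≤ (D / N^r) · aliasConstL1 κ N d`. [cite: Balaban1984PropagatorsI, p. 36 l. 20–23 with p. 38 (1.126), dictionary] [cite: TrefethenWeideman2014, Thm. 4.2 eq. (4.16) with §4 eq. (4.9), p. 13–14] -/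
theorem norm_torusKernel_zero_sub_latticeKernel_zero_le_deriv_l1 {G : (Fin (d + 1) → ℂ) → ℂ} {κ M D : ℝ}
    (h : StripRegularC G κ M) (hκ : 0 < κ) (r : ℕ)
    (F : Fin (d + 1) → ℕ → (Fin (d + 1) → ℂ) → ℂ) (hF0 : ∀ μ, F μ 0 = G)
    (hint : ∀ μ, ∀ j ≤ r, ∀ x, IntegrableOn (integrand (F μ j) x) (BZ (d + 1)))
    (hder : ∀ μ, ∀ j < r, ∀ q ∈ BZ d, ∀ t ∈ Set.uIcc (-π) π,
      HasDerivAt (fun s : ℝ => F μ j (μ.insertNth (s : ℂ) (ofRealVec q))) (F μ (j + 1) (μ.insertNth (t : ℂ) (ofRealVec q))) t)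
    (hcont : ∀ μ, ∀ j ≤ r, ∀ q ∈ BZ d, ContinuousOn (fun s : ℝ => F μ j (μ.insertNth (s : ℂ) (ofRealVec q))) (Set.uIcc (-π) π))
    (hper : ∀ μ, ∀ j < r, ∀ q ∈ BZ d,
      F μ j (μ.insertNth (((-π : ℝ)) : ℂ) (ofRealVec q)) = F μ j (μ.insertNth ((π : ℝ) : ℂ) (ofRealVec q)))
    (hH : ∀ μ, StripRegularC (F μ r) κ D) {N : ℕ} (hN : 1 ≤ N) :
    ‖torusKernel (descendC G (h.toStripRegular hκ.le) hκ.le) N 0 - latticeKernel G 0‖ ≤ D / (N : ℝ) ^ r * aliasConstL1 κ N d := by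
  rw [torusKernel_descend_eq (h.toStripRegular hκ.le) hκ hN 0]
  have h0 : (0 : Fin (d + 1) → ℂ) ∈ PolyStrip (fun _ : Fin (d + 1) => κ) := fun _ => by
    simp only [Pi.zero_apply, Complex.zero_re, Complex.zero_im, abs_zero]
    exact ⟨Real.pi_pos.le, hκ.le⟩
  have hD : 0 ≤ D := le_trans (norm_nonneg _) ((hH 0).bound 0 h0)
  have hDN : 0 ≤ D / (N : ℝ) ^ r := div_nonneg hD (pow_nonneg (Nat.cast_nonneg N) r)
  exact (norm_tsum_translate_sub_le_l1_of_ne (latticeKernel G) hκ hDN hN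
    (fun m hm => norm_latticeKernel_translate_le_deriv_l1 hκ.le r F hF0 hint hder hcont hper hH hN m hm)).2

/-- THE EXPORT INEQUALITY, HYBRID RATE (shape of `Certified.lo_le_of_aliasing`): under the hypotheses of the previous
theorem, a ball `‖T_N − t‖ ≤ ρ`, a real `A ≥ (D / N^r) · aliasConstL1 κ N d` and a rational `lo ≤ t − ρ − A` give
`lo ≤ Re (latticeKernel G 0)`. [cite: Balaban1984PropagatorsI, p. 36 l. 20–23 with p. 38 (1.126), dictionary] [cite: TrefethenWeideman2014, Thm. 4.2 eq. (4.16) with §4 eq. (4.9), p. 13–14] -/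
theorem lo_le_of_aliasing_deriv_l1 {G : (Fin (d + 1) → ℂ) → ℂ} {κ M D : ℝ}
    (h : StripRegularC G κ M) (hκ : 0 < κ) (r : ℕ)
    (F : Fin (d + 1) → ℕ → (Fin (d + 1) → ℂ) → ℂ) (hF0 : ∀ μ, F μ 0 = G)
    (hint : ∀ μ, ∀ j ≤ r, ∀ x, IntegrableOn (integrand (F μ j) x) (BZ (d + 1)))
    (hder : ∀ μ, ∀ j < r, ∀ q ∈ BZ d, ∀ t ∈ Set.uIcc (-π) π,
      HasDerivAt (fun s : ℝ => F μ j (μ.insertNth (s : ℂ) (ofRealVec q))) (F μ (j + 1) (μ.insertNth (t : ℂ) (ofRealVec q))) t)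
    (hcont : ∀ μ, ∀ j ≤ r, ∀ q ∈ BZ d, ContinuousOn (fun s : ℝ => F μ j (μ.insertNth (s : ℂ) (ofRealVec q))) (Set.uIcc (-π) π))
    (hper : ∀ μ, ∀ j < r, ∀ q ∈ BZ d,
      F μ j (μ.insertNth (((-π : ℝ)) : ℂ) (ofRealVec q)) = F μ j (μ.insertNth ((π : ℝ) : ℂ) (ofRealVec q)))
    (hH : ∀ μ, StripRegularC (F μ r) κ D) {N : ℕ} (hN : 1 ≤ N) {t ρ : ℝ}
    (hT : ‖torusKernel (descendC G (h.toStripRegular hκ.le) hκ.le) N 0 - t‖ ≤ ρ)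
    {A : ℝ} (hA : D / (N : ℝ) ^ r * aliasConstL1 κ N d ≤ A) {lo : ℚ} (hlo : ((lo : ℚ) : ℝ) ≤ t - ρ - A) :
    ((lo : ℚ) : ℝ) ≤ (latticeKernel G 0).re := by
  have := re_ge_of_enclosures hT
    (norm_torusKernel_zero_sub_latticeKernel_zero_le_deriv_l1 h hκ r F hF0 hint hder hcont hper hH hN)
  linarith

end

end Literature.MathematicalPhysics.QuantumFieldTheory.Balaban1983to89.Beta.AliasingTailDeriv
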